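import Mathlib.Tactic.LinearCombination
import Mathlib.Tactic.FinCases
import Literature.Computability.MetaComplexity.CosetFourier
import HarnessLib

/-!
# Dual grid Schwartz–Zippel: a non-zero dual character sum has at least `2^z` non-zeros on `𝔽₃^z`

SETTING.  A field `F` of characteristic `2`, `ω ∈ F` with `ω² + ω + 1 = 0`, and the cube characters
`χ_v(u) = ω^{⟨v,u⟩}` (`HoloCoset.cubeChar ω v u`, `v ∈ 𝔽₃^z`, `u ∈ {0,1}^z`).  For coefficients
`c : {0,1}^z → F` the DUAL SUM is `Λ_c(v) = Σ_u c(u)·χ_v(u)` (`dualSum`) — a multilinear polynomial in the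
variables `y_i = ω^{v_i}`, evaluated on the grid `{1, ω, ω²}^z`.

THEOREM (`dualGridSZ`; typed verbatim by the cell qa-qnc0 as `AffBells35.DualGridSZ`, ROUND-34 §12.11
Fact 3).  If `c ≢ 0` then `Λ_c` has at least `2^z` non-zeros on `𝔽₃^z` — the degree-`(1,…,1)` /
product-form Schwartz–Zippel (Alon–Füredi) bound on the `3`-grid.  Proof by induction along `Fin.cons`:
`Λ_c(x ∷ v′) = A(v′) + ω^x·B(v′)` with `A, B` the dual sums of the two slices of `c` (`dualSum_cons`); if
the slice `c₁` vanishes the support is `𝔽₃ × supp A` (`≥ 3·2^{z}`), otherwise for every `v′ ∈ supp B` at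
most one of the three distinct values `1, ω, ω²` kills `A + y·B` (`omega_pow_val_injective`), so the
support has `≥ 2·#supp B ≥ 2^{z+1}` points.

THEOREM (`dualSZDecoupling`; typed `AffBells35.DualSZDecoupling`, ROUND-34 §12.11).  If
`R = Σ_g a_g χ_{w_g} ≡ κ` on the parity coset `H_ε`, a class `Q` of rows of coin-width `≥ D` that is
`D`-separated in Hamming distance from the rows outside `Q` has `Σ_{g∈Q} a_g χ_{w_g} ≡ 0` on `H_ε`, provided
`4(m+1)²(z+1)² < 2^D`.  Proof: the dual sum of `c = R_Q·1_{H_ε}` is `Λ(v) = Σ_{g∈Q} a_g Ŝ_ε(v + w_g)`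
`= κŜ_ε(v) − Σ_{h∉Q} a_h Ŝ_ε(v + w_h)` ((O) `sum_cosetCharSum_add_eq`); `Ŝ_ε(y) ≠ 0` forces `y` to have
`≤ 1` zero ((V)), so `supp Λ` lies in `≤ m(m+1)` box intersections `B_e ∩ B_{e′}` with `hdist(e,e′) ≥ D`,
each of size `≤ (z+1)²·2^{z−D}` (`card_box_inter_le`, an explicit injection); this is `< 2^z`,
contradicting `dualGridSZ` unless `c ≡ 0`.

Printed relatives: Alon–Füredi / Schwartz–Zippel for product grids; NOT Mathlib's total-degree
`MvPolynomial.schwartz_zippel_sup_sum` and not the tree's `2`-point grid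
`HypercubeSchwartzZippel.two_pow_le_card_support`.  The cube-character form is SUPPLIED HERE
(consumer: qa-qnc0 ROUND-34 §12.11, dual Schwartz–Zippel decoupling).  No named facts.
-/

namespace Literature.Computability.MetaComplexity

open Finset
open Literature.Computability.MetaComplexity.ParityModTestDensity
open Literature.Computability.MetaComplexity.HoloCoset
open Literature.Computability.MetaComplexity.CosetFourier

namespace DualGridSZ

variable {F : Type*} [Field F] {z : ℕ}

/-! ### 1. The dual sum and its `Fin.cons` recursion -/

/-- The dual character sum `Λ_c(v) = Σ_u c(u) χ_v(u)`.
[cite: BarringtonStraubingTherien1990, §6 (the characters Q_w); the dual sum is supplied here] -/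
def dualSum (ω : F) (c : (Fin z → Bool) → F) (v : Fin z → ZMod 3) : F :=
  ∑ u, c u * cubeChar ω v u

section Algebra

variable {ω : F}

/-- `ω³ = 1` (char 2). [folklore] -/
private theorem omega_pow_three [CharP F 2] (hω : ω ^ 2 + ω + 1 = 0) : ω ^ 3 = 1 := by
  have h2 : (2 : F) = 0 := CharTwo.two_eq_zero
  linear_combination (ω + 1) * hω - (ω ^ 2 + ω + 1) * h2

/-- [folklore] -/
private theorem pow_eq_pow_mod_three (h3 : ω ^ 3 = 1) (n : ℕ) : ω ^ n = ω ^ (n % 3) := by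
  conv_lhs => rw [← Nat.div_add_mod n 3, pow_add, pow_mul, h3, one_pow, one_mul]

/-- [folklore] -/
private theorem pow_val_add (h3 : ω ^ 3 = 1) (a b : ZMod 3) :
    ω ^ (a + b).val = ω ^ a.val * ω ^ b.val := by
  rw [ZMod.val_add, ← pow_eq_pow_mod_three h3, pow_add]

/-- `x ↦ ω^x` is injective on `ℤ₃` (char 2: `1, ω, ω²` are pairwise distinct). [folklore] -/
private theorem omega_pow_val_injective [CharP F 2] (hω : ω ^ 2 + ω + 1 = 0) {x y : ZMod 3}
    (h : ω ^ x.val = ω ^ y.val) : x = y := by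
  have h2 : (2 : F) = 0 := CharTwo.two_eq_zero
  have hω1 : ω ≠ 1 := by
    intro h1; rw [h1] at hω
    have : (1 : F) = 0 := by linear_combination hω - h2
    exact one_ne_zero this
  have hω21 : ω ^ 2 ≠ 1 := by
    intro h22
    have hω0 : ω = 0 := by linear_combination hω - h22 - h2
    rw [hω0] at h22; norm_num at h22
  have hω2ω : ω ^ 2 ≠ ω := by
    intro h22
    have : (1 : F) = 0 := by linear_combination hω - h22 - ω * h2
    exact one_ne_zero this
  obtain ⟨a, ha⟩ : ∃ a, x.val = a := ⟨_, rfl⟩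
  obtain ⟨b, hb⟩ : ∃ b, y.val = b := ⟨_, rfl⟩
  have ha3 : a < 3 := by rw [← ha]; exact x.val_lt
  have hb3 : b < 3 := by rw [← hb]; exact y.val_lt
  rw [ha, hb] at h
  interval_cases a <;> interval_cases b <;> (try simp only [pow_zero, pow_one] at h)
  · exact ZMod.val_injective 3 (ha.trans hb.symm)
  · exact absurd h.symm hω1
  · exact absurd h.symm hω21
  · exact absurd h hω1
  · exact ZMod.val_injective 3 (ha.trans hb.symm)
  · exact absurd h.symm hω2ω
  · exact absurd h hω21
  · exact absurd h hω2ω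
  · exact ZMod.val_injective 3 (ha.trans hb.symm)

/-- `χ_{x ∷ v}(b ∷ u) = (b ? ω^x : 1)·χ_v(u)` (as in the cell's `cosetCharSum_cons` toolkit). [folklore] -/
private theorem cubeChar_cons (h3 : ω ^ 3 = 1) (x : ZMod 3) (v : Fin z → ZMod 3) (b : Bool)
    (u : Fin z → Bool) :
    cubeChar ω (Fin.cons x v : Fin (z + 1) → ZMod 3) (Fin.cons b u) =
      (if b then ω ^ x.val else 1) * cubeChar ω v u := by
  unfold cubeChar
  rw [Fin.sum_univ_succ]
  simp only [Fin.cons_zero, Fin.cons_succ]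
  rw [pow_val_add h3]
  cases b <;> simp

/-- The recursion `Λ_c(x ∷ v) = Λ_{c₀}(v) + ω^x Λ_{c₁}(v)` with `c_b = c(b ∷ ·)`. [folklore] -/
private theorem dualSum_cons (h3 : ω ^ 3 = 1) (c : (Fin (z + 1) → Bool) → F) (x : ZMod 3)
    (v : Fin z → ZMod 3) :
    dualSum ω c (Fin.cons x v) =
      dualSum ω (fun u => c (Fin.cons false u)) v + ω ^ x.val * dualSum ω (fun u => c (Fin.cons true u)) v := by
  unfold dualSum
  have step : (∑ u : Fin (z + 1) → Bool, c u * cubeChar ω (Fin.cons x v : Fin (z + 1) → ZMod 3) u)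
      = ∑ b : Bool, ∑ u : Fin z → Bool,
          c (Fin.cons b u) * cubeChar ω (Fin.cons x v : Fin (z + 1) → ZMod 3) (Fin.cons b u) := by
    rw [← Fintype.sum_prod_type']
    exact (Fintype.sum_equiv (Fin.consEquiv fun _ : Fin (z + 1) => Bool) _ _ (fun p => rfl)).symm
  rw [step, Fintype.sum_bool]
  simp_rw [cubeChar_cons h3]
  simp only [if_true, Bool.false_eq_true, if_false, one_mul]
  rw [add_comm, Finset.mul_sum]
  congr 1
  exact Finset.sum_congr rfl fun u _ => by ring

end Algebra

/-! ### 2. The bound -/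

/-- **Dual grid Schwartz–Zippel (typed `AffBells35.DualGridSZ` verbatim).**  For `c : {0,1}^z → F` not
identically zero, the dual sum `v ↦ Σ_u c(u) χ_v(u)` has at least `2^z` non-zeros on `𝔽₃^z`.
(`[DecidableEq F]` only to state the count, as in `HypercubeSchwartzZippel`; from a classical statement port
with `by classical; convert dualGridSZ F ω hω z c hc`.)
[cite: BarringtonStraubingTherien1990, §6 (cube characters); the product-grid Schwartz–Zippel count in this
form is supplied here (qa-qnc0 ROUND-34 §12.11 Fact 3)] -/
theorem dualGridSZ (F : Type*) [Field F] [CharP F 2] [DecidableEq F] (ω : F) (hω : ω ^ 2 + ω + 1 = 0)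
    (z : ℕ) (c : (Fin z → Bool) → F) (hc : ∃ u, c u ≠ 0) :
    2 ^ z ≤ (univ.filter fun v : Fin z → ZMod 3 => (∑ u, c u * cubeChar ω v u) ≠ 0).card := by
  classical
  have h3 : ω ^ 3 = 1 := omega_pow_three hω
  induction z with
  | zero =>
    obtain ⟨u₀, hu₀⟩ := hc
    have hχ : ∀ (v : Fin 0 → ZMod 3) (u : Fin 0 → Bool), cubeChar ω v u = 1 := fun v u => by
      simp [cubeChar]
    have hall : (univ.filter fun v : Fin 0 → ZMod 3 => (∑ u, c u * cubeChar ω v u) ≠ 0) = univ := by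
      apply filter_true_of_mem
      intro v _
      simp_rw [hχ v, mul_one]
      rw [Fintype.sum_subsingleton _ u₀]
      exact hu₀
    rw [hall]; simp
  | succ z ih =>
    -- slices and their dual sums
    set c₀ : (Fin z → Bool) → F := fun u => c (Fin.cons false u) with hc₀
    set c₁ : (Fin z → Bool) → F := fun u => c (Fin.cons true u) with hc₁
    set A : (Fin z → ZMod 3) → F := fun v => ∑ u, c₀ u * cubeChar ω v u with hA
    set B : (Fin z → ZMod 3) → F := fun v => ∑ u, c₁ u * cubeChar ω v u with hB
    have hP : ∀ (x : ZMod 3) (v : Fin z → ZMod 3),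
        (∑ u, c u * cubeChar ω (Fin.cons x v : Fin (z + 1) → ZMod 3) u) = A v + ω ^ x.val * B v := by
      intro x v
      exact dualSum_cons h3 c x v
    -- pull the count back to ZMod 3 × (Fin z → ZMod 3) along Fin.cons
    set S := univ.filter fun v : Fin (z + 1) → ZMod 3 => (∑ u, c u * cubeChar ω v u) ≠ 0 with hS
    set S' := univ.filter fun p : ZMod 3 × (Fin z → ZMod 3) => A p.2 + ω ^ p.1.val * B p.2 ≠ 0 with hS'
    have hle : S'.card ≤ S.card := by
      refine card_le_card_of_injOn (fun p => (Fin.cons p.1 p.2 : Fin (z + 1) → ZMod 3)) ?_ ?_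
      · intro p hp
        have hp' := (mem_filter.1 (mem_coe.1 hp)).2
        refine mem_coe.2 (mem_filter.2 ⟨mem_univ _, ?_⟩)
        rw [hP]; exact hp'
      · intro p _ q _ hpq
        have h := Fin.cons_injective2 hpq
        exact Prod.ext h.1 h.2
    refine le_trans ?_ hle
    by_cases h1 : ∃ u, c₁ u ≠ 0
    · -- c₁ ≢ 0: at least two of the three values survive over every v' ∈ supp B
      have hIH := ih c₁ h1
      set SB := univ.filter fun v : Fin z → ZMod 3 => (∑ u, c₁ u * cubeChar ω v u) ≠ 0 with hSB
      have hfib : ∀ v ∈ SB, 2 ≤ (S'.filter fun p => p.2 = v).card := by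
        intro v hv
        have hBv : B v ≠ 0 := (mem_filter.1 hv).2
        set kill := univ.filter fun x : ZMod 3 => A v + ω ^ x.val * B v = 0 with hkill
        set surv := univ.filter fun x : ZMod 3 => ¬ (A v + ω ^ x.val * B v = 0) with hsurv
        have hk1 : kill.card ≤ 1 := by
          refine card_le_one.2 fun x hx y hy => ?_
          have hx' := (mem_filter.1 hx).2
          have hy' := (mem_filter.1 hy).2
          have : (ω ^ x.val - ω ^ y.val) * B v = 0 := by linear_combination hx' - hy'
          have hxy : ω ^ x.val = ω ^ y.val :=
            sub_eq_zero.1 ((mul_eq_zero.1 this).resolve_right hBv)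
          exact omega_pow_val_injective hω hxy
        have h3card : kill.card + surv.card = 3 := by
          rw [hkill, hsurv, card_filter_add_card_filter_not, card_univ, ZMod.card]
        have hsurv2 : 2 ≤ surv.card := by omega
        refine le_trans hsurv2 (card_le_card_of_injOn (fun x => (x, v)) ?_ ?_)
        · intro x hx
          have hx' := (mem_filter.1 (mem_coe.1 hx)).2
          refine mem_coe.2 (mem_filter.2 ⟨mem_filter.2 ⟨mem_univ _, hx'⟩, rfl⟩)
        · intro x _ y _ hxy
          exact (Prod.ext_iff.1 hxy).1
      calc 2 ^ (z + 1) = 2 * 2 ^ z := by ring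
        _ ≤ 2 * SB.card := Nat.mul_le_mul_left _ hIH
        _ = ∑ _v ∈ SB, 2 := by rw [sum_const, smul_eq_mul, mul_comm]
        _ ≤ ∑ v ∈ SB, (S'.filter fun p => p.2 = v).card := sum_le_sum hfib
        _ ≤ ∑ v ∈ (univ : Finset (Fin z → ZMod 3)), (S'.filter fun p => p.2 = v).card :=
            sum_le_sum_of_subset_of_nonneg (subset_univ _) fun _ _ _ => Nat.zero_le _
        _ = S'.card := (card_eq_sum_card_fiberwise (f := Prod.snd) (fun p _ => mem_univ _)).symm
    · -- c₁ ≡ 0: the support is 𝔽₃ × supp A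
      push Not at h1
      have hB0 : ∀ v, B v = 0 := fun v => by
        simp only [hB]
        exact sum_eq_zero fun u _ => by rw [h1 u, zero_mul]
      have h0 : ∃ u, c₀ u ≠ 0 := by
        obtain ⟨u, hu⟩ := hc
        rw [← Fin.cons_self_tail u] at hu
        cases hu0 : u 0
        · exact ⟨Fin.tail u, by rw [hu0] at hu; exact hu⟩
        · exact absurd (h1 (Fin.tail u)) (by rw [hu0] at hu; exact hu)
      have hIH := ih c₀ h0
      set SA := univ.filter fun v : Fin z → ZMod 3 => (∑ u, c₀ u * cubeChar ω v u) ≠ 0 with hSA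
      have hsub : (univ : Finset (ZMod 3)) ×ˢ SA ⊆ S' := by
        intro p hp
        have hA' : A p.2 ≠ 0 := (mem_filter.1 (mem_product.1 hp).2).2
        refine mem_filter.2 ⟨mem_univ _, ?_⟩
        rw [hB0, mul_zero, add_zero]; exact hA'
      calc 2 ^ (z + 1) ≤ 3 * 2 ^ z := by ring_nf; omega
        _ ≤ 3 * SA.card := Nat.mul_le_mul_left _ hIH
        _ = ((univ : Finset (ZMod 3)) ×ˢ SA).card := by rw [card_product, card_univ, ZMod.card]
        _ ≤ S'.card := card_le_card hsub

/-! ### 3. Boxes: where a coset character sum can live -/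

section Boxes

/-- A sub-cube with the coordinates in `T` pinned to `false` has `2^{z−|T|}` points (as in
`CosetFourier`'s counting section). [folklore] -/
private theorem card_filter_forall_false (T : Finset (Fin z)) :
    (univ.filter fun σ : Fin z → Bool => ∀ i ∈ T, σ i = false).card = 2 ^ (z - T.card) := by
  classical
  let e : {σ : Fin z → Bool // ∀ i ∈ T, σ i = false} ≃ ({i : Fin z // i ∉ T} → Bool) :=
    { toFun := fun σ i => σ.1 i.1
      invFun := fun g => ⟨fun i => if h : i ∈ T then false else g ⟨i, h⟩, fun i hi => by simp [hi]⟩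
      left_inv := by
        rintro ⟨σ, hσ⟩; ext i
        by_cases hi : i ∈ T
        · simp [hi, hσ i hi]
        · simp [hi]
      right_inv := by intro g; funext ⟨i, hi⟩; simp [hi] }
  have h1 : (univ.filter fun σ : Fin z → Bool => ∀ i ∈ T, σ i = false).card
      = Fintype.card {σ : Fin z → Bool // ∀ i ∈ T, σ i = false} := by
    rw [Fintype.card_subtype]
  rw [h1, Fintype.card_congr e, Fintype.card_fun, Fintype.card_bool]
  congr 1
  rw [Fintype.card_subtype_compl, Fintype.card_fin]
  congr 1
  simp [Fintype.card_subtype]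

/-- The (least) coordinate where `v + e` vanishes, if any. [folklore] -/
private def zeroAt (e v : Fin z → ZMod 3) : Option (Fin z) :=
  if h : (univ.filter fun i => v i + e i = 0).Nonempty
    then some ((univ.filter fun i => v i + e i = 0).min' h) else none

/-- With at most one zero of `v + e`, `zeroAt` locates it. [folklore] -/
private theorem zeroAt_spec (e v : Fin z → ZMod 3)
    (h1 : (univ.filter fun i => v i + e i = 0).card ≤ 1) (i : Fin z) :
    v i + e i = 0 ↔ zeroAt e v = some i := by
  classical
  have hmem : ∀ j, j ∈ (univ.filter fun i => v i + e i = 0) ↔ v j + e j = 0 := fun j => by simp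
  unfold zeroAt
  constructor
  · intro hi
    have hiZ := (hmem i).2 hi
    have hne : (univ.filter fun i => v i + e i = 0).Nonempty := ⟨i, hiZ⟩
    rw [dif_pos hne, Option.some.injEq]
    exact card_le_one.1 h1 _ (min'_mem _ hne) _ hiZ
  · intro hi
    by_cases hne : (univ.filter fun i => v i + e i = 0).Nonempty
    · rw [dif_pos hne, Option.some.injEq] at hi
      rw [← hmem, ← hi]; exact min'_mem _ hne
    · rw [dif_neg hne] at hi; exact absurd hi (by simp)

/-- **Box intersections are small**: the vectors `v` such that both `v + e` and `v + e′` have at most one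
zero coordinate number at most `(z+1)²·2^{z − #{i : e_i ≠ e′_i}}` (outside two exceptional coordinates `v_i`
avoids `−e_i, −e′_i`: one choice where they differ, two where they agree). [folklore] -/
private theorem card_box_inter_le (e e' : Fin z → ZMod 3) :
    (univ.filter fun v : Fin z → ZMod 3 =>
        (univ.filter fun i => v i + e i = 0).card ≤ 1 ∧
          (univ.filter fun i => v i + e' i = 0).card ≤ 1).card
      ≤ (z + 1) ^ 2 * 2 ^ (z - (univ.filter fun i => e i ≠ e' i).card) := by
  classical
  set T := univ.filter fun i => e i ≠ e' i with hT
  set Box := univ.filter fun v : Fin z → ZMod 3 =>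
      (univ.filter fun i => v i + e i = 0).card ≤ 1 ∧
        (univ.filter fun i => v i + e' i = 0).card ≤ 1 with hBox
  let Φ : (Fin z → ZMod 3) → (Option (Fin z) × Option (Fin z)) × (Fin z → Bool) :=
    fun v => ((zeroAt e v, zeroAt e' v), fun i => if i ∈ T then false else decide (v i + e i = 1))
  set Img := ((univ : Finset (Option (Fin z))) ×ˢ (univ : Finset (Option (Fin z)))) ×ˢ
      (univ.filter fun b : Fin z → Bool => ∀ i ∈ T, b i = false) with hImg
  have hmaps : ∀ v ∈ Box, Φ v ∈ Img := by
    intro v _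
    simp only [Φ, hImg, mem_product, mem_univ, true_and, mem_filter]
    intro i hi
    rw [if_pos hi]
  have hinj : Set.InjOn Φ ↑Box := by
    intro v hv v' hv' hΦ
    have hv1 := (mem_filter.1 (mem_coe.1 hv)).2
    have hv'1 := (mem_filter.1 (mem_coe.1 hv')).2
    simp only [Φ, Prod.mk.injEq] at hΦ
    obtain ⟨⟨hz1, hz2⟩, hb⟩ := hΦ
    funext i
    have t1 : (v i + e i = 0 ↔ v' i + e i = 0) := by
      rw [zeroAt_spec e v hv1.1 i, zeroAt_spec e v' hv'1.1 i, hz1]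
    have t2 : (v i + e' i = 0 ↔ v' i + e' i = 0) := by
      rw [zeroAt_spec e' v hv1.2 i, zeroAt_spec e' v' hv'1.2 i, hz2]
    have hbi := congrFun hb i
    by_cases hiT : i ∈ T
    · have hne : e i ≠ e' i := (mem_filter.1 hiT).2
      have key : ∀ (x x' s t : ZMod 3), s ≠ t → (x + s = 0 ↔ x' + s = 0) →
          (x + t = 0 ↔ x' + t = 0) → x = x' := by decide
      exact key _ _ _ _ hne t1 t2
    · simp only [hiT, if_false, decide_eq_decide] at hbi
      have key : ∀ (x x' s : ZMod 3), (x + s = 0 ↔ x' + s = 0) → (x + s = 1 ↔ x' + s = 1) →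
          x = x' := by decide
      exact key _ _ _ t1 hbi
  calc Box.card ≤ Img.card := card_le_card_of_injOn Φ hmaps hinj
    _ = (z + 1) ^ 2 * 2 ^ (z - T.card) := by
        rw [hImg, card_product, card_product, card_univ, Fintype.card_option, Fintype.card_fin,
          card_filter_forall_false]
        ring

variable [CharP F 2]

/-- (V) contrapositive: `Ŝ_ε(y) ≠ 0` forces `y` to have at most one zero coordinate. [folklore] -/
private theorem card_zeros_le_one_of_ne (ω : F) (ε : Bool) (y : Fin z → ZMod 3)
    (h : cosetCharSum ω z ε y ≠ 0) : (univ.filter fun i => y i = 0).card ≤ 1 := by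
  classical
  by_contra hlt
  push Not at hlt
  obtain ⟨i, hi, j, hj, hij⟩ := one_lt_card.1 hlt
  exact h (cosetCharSum_eq_zero_of_two_zeros ω ε y hij (mem_filter.1 hi).2 (mem_filter.1 hj).2)

end Boxes

/-! ### 4. Dual Schwartz–Zippel decoupling (P-38ad) -/

/-- **Dual Schwartz–Zippel decoupling (typed `AffBells35.DualSZDecoupling` verbatim).**  If
`R = Σ_g a_g χ_{w_g} ≡ κ` on `H_ε`, the class `Q` consists of rows of coin-width `≥ D` and is `D`-separated
in Hamming distance from every row outside `Q`, and `4(m+1)²(z+1)² < 2^D`, then `Σ_{g∈Q} a_g χ_{w_g}`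
vanishes on `H_ε`.  (Conjecture CD of the cell in this regime; re-proves `sparseKappa`, `holoIsolation`.)
[cite: BarringtonStraubingTherien1990, §6 (orthogonality/counting); statement and proof supplied here
(qa-qnc0 ROUND-34 §12.11)] -/
theorem dualSZDecoupling (F : Type*) [Field F] [CharP F 2] (ω : F) (hω : ω ^ 2 + ω + 1 = 0)
    (z m D : ℕ) (a : Fin m → F) (w : Fin m → Fin z → ZMod 3) (ε : Bool) (Q : Finset (Fin m)) (κ : F)
    (hD : 4 * (m + 1) ^ 2 * (z + 1) ^ 2 < 2 ^ D)
    (hwide : ∀ g ∈ Q, D ≤ (wsupp (w g)).card)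
    (hsep : ∀ g ∈ Q, ∀ h, h ∉ Q → D ≤ hdist (w g) (w h))
    (hκ : ∀ u ∈ parityCoset z ε, holoSum ω a w u = κ) :
    ∀ u ∈ parityCoset z ε, (∑ g ∈ Q, a g * cubeChar ω (w g) u) = 0 := by
  classical
  have h3 : ω ^ 3 = 1 := omega_pow_three hω
  by_contra hne
  push Not at hne
  obtain ⟨u₀, hu₀, hne⟩ := hne
  -- Q is non-empty, hence D ≤ z
  obtain ⟨g₀, hg₀⟩ := Finset.nonempty_of_sum_ne_zero hne
  have hDz : D ≤ z :=
    (hwide g₀ hg₀).trans ((card_le_card (subset_univ _)).trans (by rw [card_univ, Fintype.card_fin]))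
  -- the coefficient function R_Q · 1_{H_ε} and its dual sum
  set c : (Fin z → Bool) → F := fun u =>
    if u ∈ parityCoset z ε then ∑ g ∈ Q, a g * cubeChar ω (w g) u else 0 with hc
  have hc0 : ∃ u, c u ≠ 0 := ⟨u₀, by rw [hc]; dsimp only; rw [if_pos hu₀]; exact hne⟩
  have hSZ := dualGridSZ F ω hω z c hc0
  set S := univ.filter fun v : Fin z → ZMod 3 => (∑ u, c u * cubeChar ω v u) ≠ 0 with hS
  -- Λ(v) = Σ_{g ∈ Q} a_g Ŝ_ε(v + w_g)
  have hΛ : ∀ v, (∑ u, c u * cubeChar ω v u) = ∑ g ∈ Q, a g * cosetCharSum ω z ε (v + w g) := by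
    intro v
    have step : (∑ u, c u * cubeChar ω v u)
        = ∑ u ∈ parityCoset z ε, (∑ g ∈ Q, a g * cubeChar ω (w g) u) * cubeChar ω v u := by
      rw [← Finset.sum_filter_add_sum_filter_not univ (fun u => u ∈ parityCoset z ε)]
      have hzero : ∑ u ∈ univ.filter (fun u => ¬ u ∈ parityCoset z ε), c u * cubeChar ω v u = 0 :=
        sum_eq_zero fun u hu => by
          rw [hc]; dsimp only; rw [if_neg (mem_filter.1 hu).2, zero_mul]
      rw [hzero, add_zero]
      have hset : univ.filter (fun u => u ∈ parityCoset z ε) = parityCoset z ε := by ext u; simp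
      rw [hset]
      refine sum_congr rfl fun u hu => ?_
      rw [hc]; dsimp only; rw [if_pos hu]
    rw [step]
    unfold cosetCharSum
    calc ∑ u ∈ parityCoset z ε, (∑ g ∈ Q, a g * cubeChar ω (w g) u) * cubeChar ω v u
        = ∑ u ∈ parityCoset z ε, ∑ g ∈ Q, a g * cubeChar ω (v + w g) u := by
          refine sum_congr rfl fun u _ => ?_
          rw [Finset.sum_mul]
          exact sum_congr rfl fun g _ => by rw [← cubeChar_mul h3]; ring
      _ = ∑ g ∈ Q, a g * ∑ u ∈ parityCoset z ε, cubeChar ω (v + w g) u := by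
          rw [Finset.sum_comm]
          exact sum_congr rfl fun g _ => by rw [Finset.mul_sum]
  -- (O): the Q-part plus the rest equals κ Ŝ_ε(v)
  have hO : ∀ v, (∑ g ∈ Q, a g * cosetCharSum ω z ε (v + w g))
      + (∑ g ∈ univ.filter (fun g => g ∉ Q), a g * cosetCharSum ω z ε (v + w g))
      = κ * cosetCharSum ω z ε v := by
    intro v
    rw [← sum_cosetCharSum_add_eq hω a w hκ v,
      ← Finset.sum_filter_add_sum_filter_not univ (fun g => g ∈ Q)]
    congr 1
    have : univ.filter (fun g => g ∈ Q) = Q := by ext g; simp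
    rw [this]
  -- boxes
  let box : (Fin z → ZMod 3) → (Fin z → ZMod 3) → Finset (Fin z → ZMod 3) := fun e e' =>
    univ.filter fun v => (univ.filter fun i => v i + e i = 0).card ≤ 1 ∧
      (univ.filter fun i => v i + e' i = 0).card ≤ 1
  let U : Finset (Fin z → ZMod 3) := Q.biUnion fun g =>
    box (w g) 0 ∪ (univ.filter fun h => h ∉ Q).biUnion fun h => box (w g) (w h)
  have hsupp : S ⊆ U := by
    intro v hv
    have hv' : (∑ u, c u * cubeChar ω v u) ≠ 0 := (mem_filter.1 hv).2
    rw [hΛ] at hv'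
    obtain ⟨g, hg, hgne⟩ := exists_ne_zero_of_sum_ne_zero hv'
    have hSg : cosetCharSum ω z ε (v + w g) ≠ 0 := fun h0 => hgne (by rw [h0, mul_zero])
    have hzg := card_zeros_le_one_of_ne ω ε _ hSg
    refine mem_biUnion.2 ⟨g, hg, ?_⟩
    by_cases hSv : cosetCharSum ω z ε v = 0
    · -- then some outside row must be alive
      have hrest : (∑ h ∈ univ.filter (fun h => h ∉ Q), a h * cosetCharSum ω z ε (v + w h)) ≠ 0 := by
        intro h0
        have := hO v
        rw [h0, add_zero, hSv, mul_zero] at this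
        exact hv' this
      obtain ⟨h, hh, hhne⟩ := exists_ne_zero_of_sum_ne_zero hrest
      have hSh : cosetCharSum ω z ε (v + w h) ≠ 0 := fun h0 => hhne (by rw [h0, mul_zero])
      have hzh := card_zeros_le_one_of_ne ω ε _ hSh
      refine mem_union_right _ (mem_biUnion.2 ⟨h, hh, mem_filter.2 ⟨mem_univ _, ?_, ?_⟩⟩)
      · simpa only [Pi.add_apply] using hzg
      · simpa only [Pi.add_apply] using hzh
    · have hzv := card_zeros_le_one_of_ne ω ε _ hSv
      refine mem_union_left _ (mem_filter.2 ⟨mem_univ _, ?_, ?_⟩)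
      · simpa only [Pi.add_apply] using hzg
      · simpa only [Pi.zero_apply, add_zero] using hzv
  -- every box in U is a D-separated pair
  have hbox : ∀ e e' : Fin z → ZMod 3, D ≤ (univ.filter fun i => e i ≠ e' i).card →
      (box e e').card ≤ (z + 1) ^ 2 * 2 ^ (z - D) := by
    intro e e' hT
    refine (card_box_inter_le e e').trans (Nat.mul_le_mul_left _ ?_)
    exact Nat.pow_le_pow_right (by norm_num) (by omega)
  have hbox0 : ∀ g ∈ Q, (box (w g) 0).card ≤ (z + 1) ^ 2 * 2 ^ (z - D) := by
    intro g hg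
    refine hbox _ _ ((hwide g hg).trans (le_of_eq ?_))
    unfold wsupp; congr 1
  have hboxh : ∀ g ∈ Q, ∀ h ∈ univ.filter (fun h => h ∉ Q),
      (box (w g) (w h)).card ≤ (z + 1) ^ 2 * 2 ^ (z - D) := by
    intro g hg h hh
    exact hbox _ _ (hsep g hg h (mem_filter.1 hh).2)
  have hout : (univ.filter fun h : Fin m => h ∉ Q).card ≤ m :=
    (card_le_card (filter_subset _ _)).trans (by rw [card_univ, Fintype.card_fin])
  have hQm : Q.card ≤ m := (card_le_card (subset_univ _)).trans (by rw [card_univ, Fintype.card_fin])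
  have hU : U.card ≤ m * ((m + 1) * ((z + 1) ^ 2 * 2 ^ (z - D))) := by
    calc U.card ≤ ∑ g ∈ Q, (box (w g) 0 ∪ (univ.filter fun h => h ∉ Q).biUnion fun h => box (w g) (w h)).card :=
          card_biUnion_le
      _ ≤ ∑ g ∈ Q, ((z + 1) ^ 2 * 2 ^ (z - D) + m * ((z + 1) ^ 2 * 2 ^ (z - D))) := by
          refine sum_le_sum fun g hg => (card_union_le _ _).trans (Nat.add_le_add (hbox0 g hg) ?_)
          calc ((univ.filter fun h => h ∉ Q).biUnion fun h => box (w g) (w h)).card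
              ≤ ∑ h ∈ univ.filter (fun h => h ∉ Q), (box (w g) (w h)).card := card_biUnion_le
            _ ≤ ∑ _h ∈ univ.filter (fun h => h ∉ Q), (z + 1) ^ 2 * 2 ^ (z - D) :=
                sum_le_sum fun h hh => hboxh g hg h hh
            _ = (univ.filter fun h : Fin m => h ∉ Q).card * ((z + 1) ^ 2 * 2 ^ (z - D)) := by
                rw [sum_const, smul_eq_mul]
            _ ≤ m * ((z + 1) ^ 2 * 2 ^ (z - D)) := Nat.mul_le_mul_right _ hout
      _ = Q.card * ((m + 1) * ((z + 1) ^ 2 * 2 ^ (z - D))) := by rw [sum_const, smul_eq_mul]; ring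
      _ ≤ m * ((m + 1) * ((z + 1) ^ 2 * 2 ^ (z - D))) := Nat.mul_le_mul_right _ hQm
  -- the contradiction: 2^z ≤ #S ≤ #U ≤ m(m+1)(z+1)² 2^{z−D} < 2^z
  have h1 : 2 ^ z ≤ m * ((m + 1) * ((z + 1) ^ 2 * 2 ^ (z - D))) :=
    hSZ.trans ((card_le_card hsupp).trans hU)
  have h2 : m * (m + 1) * (z + 1) ^ 2 < 2 ^ D := by
    have : m * (m + 1) * (z + 1) ^ 2 ≤ 4 * (m + 1) ^ 2 * (z + 1) ^ 2 :=
      Nat.mul_le_mul_right _ (by nlinarith)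
    exact lt_of_le_of_lt this hD
  have hpow : 2 ^ (z - D) * 2 ^ D = 2 ^ z := by rw [← pow_add, Nat.sub_add_cancel hDz]
  have : 2 ^ z * 2 ^ D < 2 ^ z * 2 ^ D := by
    calc 2 ^ z * 2 ^ D ≤ m * ((m + 1) * ((z + 1) ^ 2 * 2 ^ (z - D))) * 2 ^ D :=
          Nat.mul_le_mul_right _ h1
      _ = m * (m + 1) * (z + 1) ^ 2 * (2 ^ (z - D) * 2 ^ D) := by ring
      _ = m * (m + 1) * (z + 1) ^ 2 * 2 ^ z := by rw [hpow]
      _ < 2 ^ D * 2 ^ z := Nat.mul_lt_mul_of_pos_right h2 (by positivity)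
      _ = 2 ^ z * 2 ^ D := by ring
  exact lt_irrefl _ this

end DualGridSZ

end Literature.Computability.MetaComplexity
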